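import Summits.ValiantsHypothesis.ValiantsHypothesis.Theorems.RigidityForcesSymmetryGrenetFirstOrderRankRigidGapDesign

/-!
# Route RigidityForcesSymmetry — `GrenetFirstOrderRankRigid` (item stmt-ValiantsHypothesis-21029),
line `grenet_gauge`: stub `stub_linearRigid`, step 5 (blocks III / I<, part 3) — the gap blocks

For the crux line `Cruxes/GrenetFirstOrderRankRigid/Lines/grenet_gauge.lean` (blueprint
`Lines/grenet_gauge-stub_linearRigid-PROOF.md`, §5, types III and I<; interface
`Lines/grenet_gauge-stub_linearRigid-BLOCKS.md`, deliverables (D-PQ), (D-tail), (D-head)).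

A tail entry `(S, T, (p, |S|))` of a homogeneous tangent direction (row vertex `S = R i`, column vertex
`T = C j`, arc `S → U := S + p`) and a head entry `(U, T + p', (p', |T|))` lie in the same torus-weight
block; the block is a GAP BLOCK when `|U| < |T|` — this covers type III (`U ⊊ T`) and type I<
(`0 < |U \ T| < |T \ U|`) of the blueprint.  Evaluating the block identity (`grenet_tangency_weightSplit`)
at the gap design (`…GapDesign`) of an ordering `σ` of `Fin n` listing `S` then `p`, and an ordering `τ`
listing `T` then `p'`, kills the permanent and every entry of the block except these two
(`gap_column_shape` leaves the tail-like and the head-like shape; the surviving lattice paths pin the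
vertices), whence

* `grenet_gap_PQ` — `A'(head entry) = - A'(tail entry)` ((D-PQ); the rank constraint is not even needed);
* `grenet_gap_tail`, `grenet_gap_head` — two tail (head) entries of the same pair agree ((D-tail), (D-head)),
  as long as a partner exists (`C j ≠ univ`, resp. `R i ≠ ∅`; the border cases are in `…GapBorders`).

No new definitions.  VP ≠ VNP is not moved by this file (first-order bookkeeping about one matrix
family).
-/

noncomputable section

open MvPolynomial Matrix Finset

namespace Summit.ValiantsHypothesis.Theorems.RigidityForcesSymmetry.GrenetGauge

open Literature.Computability.AlgebraicComplexity

/-! ### The core identity of a gap block -/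

section GapCore

variable {k : Type*} [CommRing k] [IsDomain k] {n N : ℕ} (e : Finset (Fin n) ≃ Fin (N + 1))

/-- **The core identity of a gap block** (deliverable (D-PQ) of the interface, types III and I<).  Let
`(i, j, v)` be a TAIL entry (`v = (p, |R i|)`, `p ∉ R i`, arc `R i → U := R i + p`) and `(i', j', v')` a
HEAD entry (`v' = (p', q')`, `p' ∈ C j'`, `|C j'| = q' + 1`) of a homogeneous tangent direction at
Grenet's pencil, belonging to the same pair: `R i' = U` and `C j = C j' - p'`.  If the pair has a GAP,
`|U| < |C j|`, then `A'_{v'} i' j' = - A'_v i j`.  (Evaluate the weight block of the tail entry at the gap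
design of the orderings `σ` of `U` ending with `p` and `τ` of `(C j)ᶜ` starting with `p'`: the
permanent dies, the column weights leave the tail-like and the head-like shape (`gap_column_shape`),
and the surviving lattice paths pin the two entries.) [cite: Grenet2011, Thm. 1] -/
theorem grenet_gap_PQ (hn : n ≠ 0) (hN : 2 ^ n = N + 1)
    (A' : Fin n × Fin n → Matrix (Fin N) (Fin N) k)
    (htr : ((Grenet.repr k n e).adjugate * ∑ v, (X v : MvPolynomial (Fin n × Fin n) k) • (A' v).map C).trace = 0)
    {i j : Fin N} {v : Fin n × Fin n} {i' j' : Fin N} {v' : Fin n × Fin n}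
    (htail : v.1 ∉ e.symm ((e univ).succAbove i) ∧ (v.2 : ℕ) = (e.symm ((e univ).succAbove i)).card)
    (hhead : v'.1 ∈ e.symm ((e ∅).succAbove j') ∧ (e.symm ((e ∅).succAbove j')).card = (v'.2 : ℕ) + 1)
    (hU : insert v.1 (e.symm ((e univ).succAbove i)) = e.symm ((e univ).succAbove i'))
    (hT : e.symm ((e ∅).succAbove j) = (e.symm ((e ∅).succAbove j')).erase v'.1)
    (hlt : (e.symm ((e univ).succAbove i')).card < (e.symm ((e ∅).succAbove j)).card) :
    A' v' i' j' = -A' v i j := by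
  classical
  -- notation and bookkeeping
  set S := e.symm ((e univ).succAbove i) with hSdef
  set T := e.symm ((e ∅).succAbove j) with hTdef
  set U := e.symm ((e univ).succAbove i') with hUdef
  set T' := e.symm ((e ∅).succAbove j') with hT'def
  have hRinj : ∀ a b : Fin N, e.symm ((e univ).succAbove a) = e.symm ((e univ).succAbove b) → a = b :=
    fun a b h => Fin.succAbove_right_injective (e.symm.injective h)
  have hCinj : ∀ a b : Fin N, e.symm ((e ∅).succAbove a) = e.symm ((e ∅).succAbove b) → a = b :=
    fun a b h => Fin.succAbove_right_injective (e.symm.injective h)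
  obtain ⟨hpS, hq⟩ := htail
  obtain ⟨hp'T', hq'⟩ := hhead
  have hp'T : v'.1 ∉ T := by rw [hT]; exact Finset.notMem_erase _ _
  have hT'eq : T' = insert v'.1 T := by rw [hT, Finset.insert_erase hp'T']
  have hUcard : U.card = S.card + 1 := by rw [← hU, Finset.card_insert_of_notMem hpS]
  have hTcard : T.card = (v'.2 : ℕ) := by
    have h1 := Finset.card_erase_of_mem hp'T'
    rw [← hT] at h1
    omega
  have hgap : S.card + 1 < T.card := by rw [← hUcard]; exact hlt
  have hTn : T.card < n := hTcard ▸ v'.2.isLt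
  -- the two orderings: `σ` enumerates `S` then `p`; `τ` enumerates `T` then `p'`
  obtain ⟨σ₀, hσ₀⟩ := Grenet.exists_perm_prefix_image_eq S
  obtain ⟨σ, hσ, hltS, hσp⟩ := Grenet.exists_perm_prefix_image_insert hσ₀ hpS
  obtain ⟨τ₀, hτ₀⟩ := Grenet.exists_perm_prefix_image_eq T
  obtain ⟨τ, hτ, hltT, hτp⟩ := Grenet.exists_perm_prefix_image_insert hτ₀ hp'T
  have hσU : (univ.filter fun c : Fin n => (c : ℕ) < S.card + 1).image σ = U := by
    rw [Grenet.prefix_image_succ σ hltS, hσp, hσ, hU]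
  have hτT' : (univ.filter fun c : Fin n => (c : ℕ) < T.card + 1).image τ = T' := by
    rw [Grenet.prefix_image_succ τ hltT, hτp, hτ, hT'eq]
  -- the gap design
  set d : Fin n → Fin n := fun c => if (c : ℕ) ≤ S.card then σ c else τ c with hd
  set D : Fin n × Fin n → k := fun w =>
    if ((w.2 : ℕ) ≤ S.card ∨ T.card ≤ (w.2 : ℕ)) ∧ d w.2 = w.1 then 1 else 0 with hDdef
  have hD : ∀ p c : Fin n, D (p, c) =
      if (fun c : Fin n => (c : ℕ) ≤ S.card ∨ T.card ≤ (c : ℕ)) c ∧ d c = p then 1 else 0 :=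
    fun _ _ => rfl
  have hd' : ∀ c : Fin n, d c = if (c : ℕ) ≤ S.card then σ c else τ c := fun _ => rfl
  have hact : ∀ c : Fin n, (fun c : Fin n => (c : ℕ) ≤ S.card ∨ T.card ≤ (c : ℕ)) c ↔
      ((c : ℕ) ≤ S.card ∨ T.card ≤ (c : ℕ)) := fun _ => Iff.rfl
  -- the weight block of the tail entry, evaluated at the design
  have hblock := grenet_tangency_weightSplit e (fun j => (Pi.single (Sum.inl j) 1 : Fin n ⊕ Fin n → ℕ))
    (fun c => (Pi.single (Sum.inr c) 1 : Fin n ⊕ Fin n → ℕ)) hn hN A' htr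
    ((∑ j₁ ∈ S, (Pi.single (Sum.inl j₁) 1 : Fin n ⊕ Fin n → ℕ)
        + ∑ j₁ ∈ Tᶜ, (Pi.single (Sum.inl j₁) 1 : Fin n ⊕ Fin n → ℕ)) +
      (∑ c ∈ univ.filter (fun c : Fin n => (c : ℕ) < S.card), (Pi.single (Sum.inr c) 1 : Fin n ⊕ Fin n → ℕ)
        + ∑ c ∈ univ.filter (fun c : Fin n => T.card ≤ (c : ℕ)), (Pi.single (Sum.inr c) 1 : Fin n ⊕ Fin n → ℕ))
      + ((Pi.single (Sum.inl v.1) 1 : Fin n ⊕ Fin n → ℕ) + (Pi.single (Sum.inr v.2) 1 : Fin n ⊕ Fin n → ℕ)))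
  have h := congrArg (eval D) hblock
  rw [map_sum, map_zero] at h
  -- each term of the block: only the tail entry `(i, j, v)` and the head entry `(i', j', v')` survive
  have hterm : ∀ x ∈ (univ : Finset (Fin N × Fin N × (Fin n × Fin n))).filter (fun x =>
      ((∑ j₁ ∈ e.symm ((e univ).succAbove x.1), (Pi.single (Sum.inl j₁) 1 : Fin n ⊕ Fin n → ℕ)
          + ∑ j₁ ∈ (e.symm ((e ∅).succAbove x.2.1))ᶜ, (Pi.single (Sum.inl j₁) 1 : Fin n ⊕ Fin n → ℕ)) +
        (∑ c ∈ univ.filter (fun c : Fin n => (c : ℕ) < (e.symm ((e univ).succAbove x.1)).card),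
            (Pi.single (Sum.inr c) 1 : Fin n ⊕ Fin n → ℕ)
          + ∑ c ∈ univ.filter (fun c : Fin n => (e.symm ((e ∅).succAbove x.2.1)).card ≤ (c : ℕ)),
            (Pi.single (Sum.inr c) 1 : Fin n ⊕ Fin n → ℕ))
        + ((Pi.single (Sum.inl x.2.2.1) 1 : Fin n ⊕ Fin n → ℕ) + (Pi.single (Sum.inr x.2.2.2) 1 : Fin n ⊕ Fin n → ℕ)))
      = ((∑ j₁ ∈ S, (Pi.single (Sum.inl j₁) 1 : Fin n ⊕ Fin n → ℕ)
          + ∑ j₁ ∈ Tᶜ, (Pi.single (Sum.inl j₁) 1 : Fin n ⊕ Fin n → ℕ)) +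
        (∑ c ∈ univ.filter (fun c : Fin n => (c : ℕ) < S.card), (Pi.single (Sum.inr c) 1 : Fin n ⊕ Fin n → ℕ)
          + ∑ c ∈ univ.filter (fun c : Fin n => T.card ≤ (c : ℕ)), (Pi.single (Sum.inr c) 1 : Fin n ⊕ Fin n → ℕ))
        + ((Pi.single (Sum.inl v.1) 1 : Fin n ⊕ Fin n → ℕ) + (Pi.single (Sum.inr v.2) 1 : Fin n ⊕ Fin n → ℕ)))),
      eval D (C (A' x.2.2 x.1 x.2.1) *
          (perPoly (Fin n) k * (1 - Grenet.adj k n).adjugate (e.symm ((e ∅).succAbove x.2.1))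
              (e.symm ((e univ).succAbove x.1)) * X x.2.2
            - (1 - Grenet.adj k n).adjugate ∅ (e.symm ((e univ).succAbove x.1)) * X x.2.2
              * (1 - Grenet.adj k n).adjugate (e.symm ((e ∅).succAbove x.2.1)) univ))
        = -(A' x.2.2 x.1 x.2.1 * if x = (i, j, v) ∨ x = (i', j', v') then 1 else 0) := by
    rintro ⟨i'', j'', v''⟩ hx
    have hw := (Finset.mem_filter.mp hx).2
    simp only at hw ⊢
    set S'' := e.symm ((e univ).succAbove i'') with hS''def
    set T'' := e.symm ((e ∅).succAbove j'') with hT''def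
    -- the column weights
    have hcol : ∀ c, c < n → (if c < S''.card then 1 else 0) + (if T''.card ≤ c then 1 else 0)
        + (if c = (v''.2 : ℕ) then 1 else 0)
        = (if c < S.card then 1 else 0) + (if T.card ≤ c then 1 else 0) + (if c = S.card then (1 : ℕ) else 0) := by
      intro c hc
      have h1 := congrFun hw (Sum.inr ⟨c, hc⟩)
      rw [weightE_apply_inr, weightE_apply_inr, ite_fin_eq_eq_ite_val_eq, ite_fin_eq_eq_ite_val_eq, hq] at h1
      simpa only [Fin.val_mk] using h1
    have hshape := gap_column_shape hgap hTn.le ((Finset.card_le_univ T'').trans_eq (Fintype.card_fin n))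
      v''.2.isLt hcol
    have hS''le : S''.card ≤ S.card + 1 := by rcases hshape with h' | h' <;> omega
    have hT''ge : T.card ≤ T''.card := by rcases hshape with h' | h' <;> omega
    -- evaluate the term
    rw [map_mul, eval_C, map_sub, map_mul, map_mul, map_mul, map_mul,
      evalGap_perPoly k S.card T.card D d _ hD hact hgap hTn.le, zero_mul, zero_mul, zero_sub, eval_X,
      evalGap_W_empty k σ τ S.card T.card D d _ hD hd' hact S'' hS''le,
      evalGap_W_univ k σ τ S.card T.card D d _ hD hd' hact (by omega) T'' hT''ge, mul_neg, neg_inj]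
    have hDv : D v'' = if (((v''.2 : ℕ) ≤ S.card ∨ T.card ≤ (v''.2 : ℕ)) ∧ d v''.2 = v''.1) then 1 else 0 := rfl
    rw [hDv, ite_mul_ite_mul_ite]
    suffices key : ((univ.filter fun c : Fin n => (c : ℕ) < S''.card).image σ = S'' ∧
        (((v''.2 : ℕ) ≤ S.card ∨ T.card ≤ (v''.2 : ℕ)) ∧ d v''.2 = v''.1) ∧
        (univ.filter fun c : Fin n => (c : ℕ) < T''.card).image τ = T'') ↔
        ((i'', j'', v'') = (i, j, v) ∨ (i'', j'', v'') = (i', j', v')) by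
      by_cases hc : ((univ.filter fun c : Fin n => (c : ℕ) < S''.card).image σ = S'' ∧
          (((v''.2 : ℕ) ≤ S.card ∨ T.card ≤ (v''.2 : ℕ)) ∧ d v''.2 = v''.1) ∧
          (univ.filter fun c : Fin n => (c : ℕ) < T''.card).image τ = T'')
      · rw [if_pos hc, if_pos (key.mp hc)]
      · rw [if_neg hc, if_neg fun h' => hc (key.mpr h')]
    -- identification of the surviving entries
    rcases hshape with ⟨hs, ht, hqq⟩ | ⟨hs, ht, hqq, -⟩
    · -- tail-like: it is the tail entry `(i, j, v)`
      have hq2 : v''.2 = ⟨S.card, hltS⟩ := Fin.ext hqq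
      have hdq : d v''.2 = v.1 := by rw [hd', if_pos (by omega), hq2, hσp]
      constructor
      · rintro ⟨h1, ⟨-, h2⟩, h3⟩
        left
        rw [hs, hσ] at h1
        rw [ht, hτ] at h3
        rw [hdq] at h2
        have hi : i'' = i := hRinj _ _ h1.symm
        have hj : j'' = j := hCinj _ _ h3.symm
        have hv : v'' = v := Prod.ext h2.symm (Fin.ext (by rw [hqq, hq]))
        rw [hi, hj, hv]
      · rintro (h1 | h1)
        · have hi : i'' = i := congrArg Prod.fst h1
          have hj : j'' = j := congrArg (fun x => x.2.1) h1
          have hv : v'' = v := congrArg (fun x => x.2.2) h1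
          refine ⟨?_, ⟨Or.inl (by omega), by rw [hdq, hv]⟩, ?_⟩
          · rw [hs, hσ, hS''def, hi]
          · rw [ht, hτ, hT''def, hj]
        · exfalso
          have h2 : i'' = i' := congrArg Prod.fst h1
          have : S''.card = U.card := by rw [hS''def, hUdef, h2]
          omega
    · -- head-like: it is the head entry `(i', j', v')`
      have hq2 : v''.2 = ⟨T.card, hltT⟩ := Fin.ext hqq
      have hdq : d v''.2 = v'.1 := by rw [hd', if_neg (by omega), hq2, hτp]
      constructor
      · rintro ⟨h1, ⟨-, h2⟩, h3⟩
        right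
        rw [hs, hσU] at h1
        rw [ht, hτT'] at h3
        rw [hdq] at h2
        have hi : i'' = i' := hRinj _ _ h1.symm
        have hj : j'' = j' := hCinj _ _ h3.symm
        have hv : v'' = v' := Prod.ext h2.symm (Fin.ext (by rw [hqq, hTcard]))
        rw [hi, hj, hv]
      · rintro (h1 | h1)
        · exfalso
          have h2 : i'' = i := congrArg Prod.fst h1
          have : S''.card = S.card := by rw [hS''def, hSdef, h2]
          omega
        · have hi : i'' = i' := congrArg Prod.fst h1
          have hj : j'' = j' := congrArg (fun x => x.2.1) h1
          have hv : v'' = v' := congrArg (fun x => x.2.2) h1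
          refine ⟨?_, ⟨Or.inr (by omega), by rw [hdq, hv]⟩, ?_⟩
          · rw [hs, hσU, hS''def, hi]
          · rw [ht, hτT', hT''def, hj]
  rw [Finset.sum_congr rfl hterm, Finset.sum_neg_distrib, neg_eq_zero] at h
  -- the two surviving entries
  have hne : ((i, j, v) : Fin N × Fin N × (Fin n × Fin n)) ≠ (i', j', v') := by
    intro h1
    have h2 : v.2 = v'.2 := congrArg (fun x => x.2.2.2) h1
    have h3 : (v.2 : ℕ) = (v'.2 : ℕ) := congrArg Fin.val h2
    omega
  have hxt : ((i, j, v) : Fin N × Fin N × (Fin n × Fin n)) ∈ (univ : Finset (Fin N × Fin N × (Fin n × Fin n))).filter (fun x =>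
      ((∑ j₁ ∈ e.symm ((e univ).succAbove x.1), (Pi.single (Sum.inl j₁) 1 : Fin n ⊕ Fin n → ℕ)
          + ∑ j₁ ∈ (e.symm ((e ∅).succAbove x.2.1))ᶜ, (Pi.single (Sum.inl j₁) 1 : Fin n ⊕ Fin n → ℕ)) +
        (∑ c ∈ univ.filter (fun c : Fin n => (c : ℕ) < (e.symm ((e univ).succAbove x.1)).card),
            (Pi.single (Sum.inr c) 1 : Fin n ⊕ Fin n → ℕ)
          + ∑ c ∈ univ.filter (fun c : Fin n => (e.symm ((e ∅).succAbove x.2.1)).card ≤ (c : ℕ)),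
            (Pi.single (Sum.inr c) 1 : Fin n ⊕ Fin n → ℕ))
        + ((Pi.single (Sum.inl x.2.2.1) 1 : Fin n ⊕ Fin n → ℕ) + (Pi.single (Sum.inr x.2.2.2) 1 : Fin n ⊕ Fin n → ℕ)))
      = ((∑ j₁ ∈ S, (Pi.single (Sum.inl j₁) 1 : Fin n ⊕ Fin n → ℕ)
          + ∑ j₁ ∈ Tᶜ, (Pi.single (Sum.inl j₁) 1 : Fin n ⊕ Fin n → ℕ)) +
        (∑ c ∈ univ.filter (fun c : Fin n => (c : ℕ) < S.card), (Pi.single (Sum.inr c) 1 : Fin n ⊕ Fin n → ℕ)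
          + ∑ c ∈ univ.filter (fun c : Fin n => T.card ≤ (c : ℕ)), (Pi.single (Sum.inr c) 1 : Fin n ⊕ Fin n → ℕ))
        + ((Pi.single (Sum.inl v.1) 1 : Fin n ⊕ Fin n → ℕ) + (Pi.single (Sum.inr v.2) 1 : Fin n ⊕ Fin n → ℕ)))) :=
    Finset.mem_filter.mpr ⟨Finset.mem_univ _, rfl⟩
  have hxh : ((i', j', v') : Fin N × Fin N × (Fin n × Fin n)) ∈ (univ : Finset (Fin N × Fin N × (Fin n × Fin n))).filter (fun x =>
      ((∑ j₁ ∈ e.symm ((e univ).succAbove x.1), (Pi.single (Sum.inl j₁) 1 : Fin n ⊕ Fin n → ℕ)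
          + ∑ j₁ ∈ (e.symm ((e ∅).succAbove x.2.1))ᶜ, (Pi.single (Sum.inl j₁) 1 : Fin n ⊕ Fin n → ℕ)) +
        (∑ c ∈ univ.filter (fun c : Fin n => (c : ℕ) < (e.symm ((e univ).succAbove x.1)).card),
            (Pi.single (Sum.inr c) 1 : Fin n ⊕ Fin n → ℕ)
          + ∑ c ∈ univ.filter (fun c : Fin n => (e.symm ((e ∅).succAbove x.2.1)).card ≤ (c : ℕ)),
            (Pi.single (Sum.inr c) 1 : Fin n ⊕ Fin n → ℕ))
        + ((Pi.single (Sum.inl x.2.2.1) 1 : Fin n ⊕ Fin n → ℕ) + (Pi.single (Sum.inr x.2.2.2) 1 : Fin n ⊕ Fin n → ℕ)))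
      = ((∑ j₁ ∈ S, (Pi.single (Sum.inl j₁) 1 : Fin n ⊕ Fin n → ℕ)
          + ∑ j₁ ∈ Tᶜ, (Pi.single (Sum.inl j₁) 1 : Fin n ⊕ Fin n → ℕ)) +
        (∑ c ∈ univ.filter (fun c : Fin n => (c : ℕ) < S.card), (Pi.single (Sum.inr c) 1 : Fin n ⊕ Fin n → ℕ)
          + ∑ c ∈ univ.filter (fun c : Fin n => T.card ≤ (c : ℕ)), (Pi.single (Sum.inr c) 1 : Fin n ⊕ Fin n → ℕ))
        + ((Pi.single (Sum.inl v.1) 1 : Fin n ⊕ Fin n → ℕ) + (Pi.single (Sum.inr v.2) 1 : Fin n ⊕ Fin n → ℕ)))) := by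
    refine Finset.mem_filter.mpr ⟨Finset.mem_univ _, ?_⟩
    simp only
    funext x
    cases x with
    | inl j₁ =>
      rw [weightE_apply_inl, weightE_apply_inl, ← hUdef, ← hT'def, ← hU, hT'eq]
      exact weightPair_inl S T v.1 v'.1 j₁ hpS hp'T
    | inr c =>
      rw [weightE_apply_inr, weightE_apply_inr, ← hUdef, ← hT'def, hUcard, hT'eq, Finset.card_insert_of_notMem hp'T,
        ite_fin_eq_eq_ite_val_eq, ite_fin_eq_eq_ite_val_eq, hq, ← hTcard]
      split_ifs <;> omega
  rw [Finset.sum_eq_add_of_mem _ _ hxt hxh hne (fun x _ hx => by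
    rw [if_neg (not_or.mpr hx), mul_zero]), if_pos (Or.inl rfl), if_pos (Or.inr rfl), mul_one, mul_one] at h
  linear_combination h

end GapCore

/-! ### Deliverables (D-tail) and (D-head) for gap pairs -/

section GapTailHead

variable {k : Type*} [CommRing k] [IsDomain k] {n N : ℕ} (e : Finset (Fin n) ≃ Fin (N + 1))

/-- **(D-tail) for gap pairs.**  Two tail entries `(i, j, v)`, `(i₂, j, v₂)` of a homogeneous tangent
direction at Grenet's pencil with the same arc target `R i + v.1 = R i₂ + v₂.1 =: U` and the same column
vertex `C j ≠ univ`, `|U| < |C j|`, have equal values: both are `-A'` of the common head partner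
(`grenet_gap_PQ`).  (Types III and I< of the blueprint; genuineness is not needed.)
[cite: Grenet2011, Thm. 1] -/
theorem grenet_gap_tail (hn : n ≠ 0) (hN : 2 ^ n = N + 1)
    (A' : Fin n × Fin n → Matrix (Fin N) (Fin N) k)
    (htr : ((Grenet.repr k n e).adjugate * ∑ v, (X v : MvPolynomial (Fin n × Fin n) k) • (A' v).map C).trace = 0)
    {i j : Fin N} {v : Fin n × Fin n} {i₂ : Fin N} {v₂ : Fin n × Fin n}
    (htail : v.1 ∉ e.symm ((e univ).succAbove i) ∧ (v.2 : ℕ) = (e.symm ((e univ).succAbove i)).card)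
    (htail₂ : v₂.1 ∉ e.symm ((e univ).succAbove i₂) ∧ (v₂.2 : ℕ) = (e.symm ((e univ).succAbove i₂)).card)
    (hUU : insert v.1 (e.symm ((e univ).succAbove i)) = insert v₂.1 (e.symm ((e univ).succAbove i₂)))
    (hlt : (insert v.1 (e.symm ((e univ).succAbove i))).card < (e.symm ((e ∅).succAbove j)).card)
    (hTu : e.symm ((e ∅).succAbove j) ≠ univ) :
    A' v i j = A' v₂ i₂ j := by
  classical
  -- the common head partner `(i', j', v')`
  have hTn : (e.symm ((e ∅).succAbove j)).card < n := by
    have := (Finset.card_lt_iff_ne_univ _).mpr hTu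
    rwa [Fintype.card_fin] at this
  obtain ⟨p', hp'⟩ : ∃ p', p' ∉ e.symm ((e ∅).succAbove j) := by
    by_contra h
    push Not at h
    exact hTu (Finset.eq_univ_iff_forall.mpr h)
  obtain ⟨j', hj'⟩ := exists_grenet_col_eq e (Finset.insert_ne_empty p' (e.symm ((e ∅).succAbove j)))
  have hUne : insert v.1 (e.symm ((e univ).succAbove i)) ≠ univ := fun h => by
    rw [h, Finset.card_univ, Fintype.card_fin] at hlt
    exact absurd ((Finset.card_le_univ _).trans_eq (Fintype.card_fin n)) (not_le.mpr hlt)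
  obtain ⟨i', hi'⟩ := exists_grenet_row_eq e hUne
  have hhead : ((p', (⟨(e.symm ((e ∅).succAbove j)).card, hTn⟩ : Fin n)) : Fin n × Fin n).1 ∈
        e.symm ((e ∅).succAbove j') ∧
      (e.symm ((e ∅).succAbove j')).card
        = ((((p', (⟨(e.symm ((e ∅).succAbove j)).card, hTn⟩ : Fin n)) : Fin n × Fin n).2 : Fin n) : ℕ) + 1 := by
    refine ⟨by rw [hj']; exact Finset.mem_insert_self _ _, ?_⟩
    rw [hj', Finset.card_insert_of_notMem hp']
  have hT : e.symm ((e ∅).succAbove j) = (e.symm ((e ∅).succAbove j')).erase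
      ((p', (⟨(e.symm ((e ∅).succAbove j)).card, hTn⟩ : Fin n)) : Fin n × Fin n).1 := by
    rw [hj', Finset.erase_insert hp']
  have hlt' : (e.symm ((e univ).succAbove i')).card < (e.symm ((e ∅).succAbove j)).card := by rwa [hi']
  have h1 := grenet_gap_PQ e hn hN A' htr htail hhead hi'.symm hT hlt'
  have h2 := grenet_gap_PQ e hn hN A' htr htail₂ hhead (hUU ▸ hi'.symm) hT hlt'
  rw [h1] at h2
  exact neg_inj.mp h2

/-- **(D-head) for gap pairs.**  Two head entries `(i, j, v)`, `(i, j₂, v₂)` of a homogeneous tangent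
direction at Grenet's pencil with the same row vertex `R i ≠ ∅` and the same arc source
`C j - v.1 = C j₂ - v₂.1 =: T`, `|R i| < |T|`, have equal values: both are `-A'` of a common tail partner
(`grenet_gap_PQ`).  (Types III and I< of the blueprint; genuineness is not needed.)
[cite: Grenet2011, Thm. 1] -/
theorem grenet_gap_head (hn : n ≠ 0) (hN : 2 ^ n = N + 1)
    (A' : Fin n × Fin n → Matrix (Fin N) (Fin N) k)
    (htr : ((Grenet.repr k n e).adjugate * ∑ v, (X v : MvPolynomial (Fin n × Fin n) k) • (A' v).map C).trace = 0)
    {i j : Fin N} {v : Fin n × Fin n} {j₂ : Fin N} {v₂ : Fin n × Fin n}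
    (hhead : v.1 ∈ e.symm ((e ∅).succAbove j) ∧ (e.symm ((e ∅).succAbove j)).card = (v.2 : ℕ) + 1)
    (hhead₂ : v₂.1 ∈ e.symm ((e ∅).succAbove j₂) ∧ (e.symm ((e ∅).succAbove j₂)).card = (v₂.2 : ℕ) + 1)
    (hRR : (e.symm ((e ∅).succAbove j)).erase v.1 = (e.symm ((e ∅).succAbove j₂)).erase v₂.1)
    (hlt : (e.symm ((e univ).succAbove i)).card < ((e.symm ((e ∅).succAbove j)).erase v.1).card)
    (hS0 : e.symm ((e univ).succAbove i) ≠ ∅) :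
    A' v i j = A' v₂ i j₂ := by
  classical
  -- a common tail partner `(i₁, j₁, v₁)`
  obtain ⟨p, hp⟩ := Finset.nonempty_iff_ne_empty.mpr hS0
  have hSne : (e.symm ((e univ).succAbove i)).erase p ≠ univ := fun h =>
    Finset.notMem_erase p _ (h ▸ Finset.mem_univ p)
  obtain ⟨i₁, hi₁⟩ := exists_grenet_row_eq e hSne
  have hTne : (e.symm ((e ∅).succAbove j)).erase v.1 ≠ ∅ := fun h => by
    rw [h, Finset.card_empty] at hlt
    exact Nat.not_lt_zero _ hlt
  obtain ⟨j₁, hj₁⟩ := exists_grenet_col_eq e hTne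
  have hSn : ((e.symm ((e univ).succAbove i)).erase p).card < n := by
    have h1 := Finset.card_erase_lt_of_mem hp
    have h2 := (Finset.card_le_univ (e.symm ((e univ).succAbove i))).trans_eq (Fintype.card_fin n)
    omega
  have htail : ((p, (⟨((e.symm ((e univ).succAbove i)).erase p).card, hSn⟩ : Fin n)) : Fin n × Fin n).1 ∉
        e.symm ((e univ).succAbove i₁) ∧
      ((((p, (⟨((e.symm ((e univ).succAbove i)).erase p).card, hSn⟩ : Fin n)) : Fin n × Fin n).2 : Fin n) : ℕ)
        = (e.symm ((e univ).succAbove i₁)).card := by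
    refine ⟨by rw [hi₁]; exact Finset.notMem_erase _ _, by rw [hi₁]⟩
  have hU : insert ((p, (⟨((e.symm ((e univ).succAbove i)).erase p).card, hSn⟩ : Fin n)) : Fin n × Fin n).1
      (e.symm ((e univ).succAbove i₁)) = e.symm ((e univ).succAbove i) := by
    rw [hi₁, Finset.insert_erase hp]
  have hlt' : (e.symm ((e univ).succAbove i)).card < (e.symm ((e ∅).succAbove j₁)).card := by rwa [hj₁]
  have h1 := grenet_gap_PQ e hn hN A' htr htail hhead hU hj₁ hlt'
  have h2 := grenet_gap_PQ e hn hN A' htr htail hhead₂ hU (hj₁.trans hRR) hlt'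
  rw [h1, h2]

end GapTailHead

end Summit.ValiantsHypothesis.Theorems.RigidityForcesSymmetry.GrenetGauge
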